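import Summits.ABC.IUTFork.Thm311RealInd1UnitsShearAnalytic
import HarnessLib

/-!
# The unit-group shear at `v₇ = (√7)` of `ℚ(√7)`, III: THE FREEDOM THEOREM — norm rigidity does NOT
# decide whether print's (Ind1) units transport preserves `μ·U^{(2)}`

Record file (D-0012) of the abc-iut cell (TEAM R «refutation (identified-copies reading)», lead seat
abc-iut-c312-14 = R1, gen 7); sequel of `Thm311RealInd1UnitsShearCore/Analytic.lean`; answer-side support
for abc-iut-c312-1 (gen 8)'s 2026-08-26T16:41:26Z «disprover-wanted» print-(Ind1)-MOVER question (the R9f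
OPEN POINT of `Thm311RealInd1StripLattices.lean`).  TAKES NO SIDE on [IUTchIII] Cor. 3.12.

WHAT IS PROVED.  `shearEquiv : 𝒪_{v₇}^× ≃* 𝒪_{v₇}^×` — the unit-group shear `α(u) = u·exp(d(log u))`,
`d = g − id`, `g(a·1 + b·Ω) = a·1 + (7⁻¹a − b)·Ω` — is an INVOLUTIVE automorphism of the unit group of the
completed ring of integers at the tame quadratically ramified place `v₇` of `F₇ = ℚ(√7)` which

* is **norm-rigid**: `N_{K₇/ℚ₇}(α u) = N_{K₇/ℚ₇}(u)` (`algebraNorm_xval_shearFun`) — EXACTLY the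
  constraint the tree has proved for EVERY print-(Ind1) units transport `Real.liftUnits v φ`
  (`norm_liftUnits_of_mem`, [AbsAnab] Prop. 1.2.1 (iii)/(vi); the `ℚ₇`-algebra structure here IS
  `LocalField.adicCompletionPadicAlgebra v₇ 7` — `RescaledCompletion.instAlgebra` — so the two spellings
  agree definitionally);
* **fixes the torsion `μ` pointwise** (`shearFun_of_pow_eq_one`) and **preserves the principal units
  `U^{(1)}`** (`shearFun_principal`) — as the decided cases of `liftUnits` (inner, local degree one,
  valuation-preserving field automorphisms) all do;
* yet **MOVES `μ·U^{(2)}`** (`exists_mover_witness`, and the headline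
  `exists_normRigid_involution_moves_muU2`): there is `u₀` with `‖1 − u₀‖ ≤ ‖Ω‖²` (so `u₀ ∈ U^{(2)}`,
  i.e. `v(u₀ − 1) ≥ 2` in `K_{v₇}`) such that `α u₀` is NOT of the form `ζ·w` with `ζ` torsion and
  `w ∈ U^{(2)}`  (`log α(u₀) = 7 + Ω` has norm `‖Ω‖ > ‖Ω‖²`).

CONSEQUENCE FOR THE R9f OPEN POINT (recorded here, proved in the sequel `…ShearStrip.lean`): the constraint
set the tree has established about `β = Real.liftUnits v φ` — norm rigidity plus the decided cases — does
NOT decide c312-1's question «does `β` preserve `μ·U_v^{(m)}`, `m ≥ 2`, for arbitrary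
`φ ∈ Aut_top(G_v)`?»: `shearEquiv` satisfies every established constraint and moves `μ·U^{(2)}`.  So (i)
any proof of the `∀`-horn must use NON-ABELIAN input beyond [AbsAnab] Prop. 1.2.1 (i)–(vii) — no
norm-rigidity argument can close it; (ii) the `∃`-horn (a print-(Ind1) MOVER) is reduced to the single
lifting statement «∃ φ ∈ Aut_top(G_{v₇}) whose units transport is `shearEquiv`» (equivalently, realises it
on `𝒪_{v₇}^×⧸μ`) — the GAP-LEDGER row filed with this file.  CROSS-REFERENCE (same question, parallel
landing): c312-1 g9's `Thm311RealInd1StripTwistMover.lean` (p467710) + GAP row G-c312-1-g9-1 discharge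
the NON-ABELIAN input via Jannsen–Wingberg TRANSVECTIONS (K. Kondo, arXiv:2512.09231, §2 Thm 2.3; NSW
Thm 7.5.14) — but that route needs `[K_v : ℚ_p] ≥ 3`; at `d = 2` (THIS file's `v₇`, every tame
quadratically ramified place) the lifting statement remains open in BOTH directions, and this file shows
no norm-rigidity argument can close it (S. Mochizuki, Int. J. Math. 8 (1997): filtration-preserving ⇔
geometric for the FULL group, so a mover `φ` must be non-geometric).  Continuity of `liftUnits` is
itself untyped in the tree; no continuity is claimed for `shearEquiv` (its realisation `ψ = g` on `K₇`
in the sequel IS bicontinuous).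

[cite: NeukirchANT1999, Ch. II Prop. (5.5)] [cite: Koblitz1984, Ch. IV §1–2]
[cite: MochizukiAbsAnab2004, Prop 1.2.1 (iii) p.10] [claim: Mochizuki2012, status: disputed] for every
[IUTchIII] locution.  Nothing here asserts or refutes [IUTchIII] Cor. 3.12; typed ≠ proved.
-/

set_option autoImplicit false

noncomputable section

namespace Summit.ABC.IUTFork.Thm311.Real.UnitsShear

open Literature.IUT.LogVolume Literature.NumberTheory.NumberFields
open NumberField IsDedekindDomain Metric IsUltrametricDist
open Summit.ABC.IUTFork.RamifiedMover
open Summit.ABC.IUTFork.Thm311.Real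

/-! ## 1. Units of `𝒪_{v₇}` and their `K₇`-values -/

/-- The `K₇`-value of a unit of `𝒪_{v₇}` (read through `e₇ = RescaledCompletion.of`). [folklore] -/
def xval (u : (↥(v7.adicCompletionIntegers ↥F7))ˣ) : K7 :=
  e7 (((u : ↥(v7.adicCompletionIntegers ↥F7))) : v7.adicCompletion ↥F7)

/-- `‖xval u‖ = 1` (abc-iut-L5-t5). [folklore] -/
theorem norm_xval (u : (↥(v7.adicCompletionIntegers ↥F7))ˣ) : ‖xval u‖ = 1 :=
  norm_of_coe_unit_adicCompletionIntegers ↥F7 7 v7 seven_mem_v7 u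

/-- `xval` is multiplicative. [folklore] -/
theorem xval_mul (u w : (↥(v7.adicCompletionIntegers ↥F7))ˣ) :
    xval (u * w) = xval u * xval w := by
  simp only [xval, Units.val_mul, MulMemClass.coe_mul, map_mul]

/-- `xval 1 = 1`. [folklore] -/
theorem xval_one : xval (1 : (↥(v7.adicCompletionIntegers ↥F7))ˣ) = 1 := by
  simp only [xval, Units.val_one, OneMemClass.coe_one, map_one]

/-- `xval` as a monoid homomorphism. [folklore] -/
def xvalHom : (↥(v7.adicCompletionIntegers ↥F7))ˣ →* K7 :=
  { toFun := xval, map_one' := xval_one, map_mul' := xval_mul }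

/-- `xval` of a power. [folklore] -/
theorem xval_pow (u : (↥(v7.adicCompletionIntegers ↥F7))ˣ) (n : ℕ) :
    xval (u ^ n) = xval u ^ n := map_pow xvalHom u n

/-- `xval` is injective. [folklore] -/
theorem xval_injective : Function.Injective xval := fun _ _ h =>
  Units.ext (Subtype.ext (e7.injective h))

/-! ## 2. Units from norm-one values -/

/-- `‖y‖ ≤ 1` puts `e₇⁻¹ y` in `𝒪_{v₇}` (the rescaled and the `v`-adic unit balls agree;
abc-iut-S7/L5-t5). [folklore] -/
theorem mem_integers_e7_symm {y : K7} (hy : ‖y‖ ≤ 1) :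
    e7.symm y ∈ v7.adicCompletionIntegers ↥F7 := by
  have h1 : ‖e7.symm y‖ ≤ 1 := by
    have h := RescaledCompletion.norm_eq_norm_of_pow ↥F7 7 v7 seven_mem_v7 (e7.symm y)
    have h2 : RescaledCompletion.of ↥F7 7 v7 seven_mem_v7 (e7.symm y) = y :=
      e7.apply_symm_apply y
    rw [h, h2]
    exact pow_le_one₀ (norm_nonneg _) hy
  exact Valued.toNormedField.norm_le_one_iff.mp h1

/-- **The unit of `𝒪_{v₇}` with value `y`**, for `‖y‖ = 1`. [folklore] -/
def unitOf {y : K7} (hy : ‖y‖ = 1) : (↥(v7.adicCompletionIntegers ↥F7))ˣ where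
  val := ⟨e7.symm y, mem_integers_e7_symm hy.le⟩
  inv := ⟨e7.symm y⁻¹, mem_integers_e7_symm (by rw [norm_inv, hy, inv_one])⟩
  val_inv := by
    have hy0 : y ≠ 0 := by intro h; rw [h, norm_zero] at hy; norm_num at hy
    apply Subtype.ext
    simp only [MulMemClass.coe_mul, OneMemClass.coe_one]
    rw [← map_mul, mul_inv_cancel₀ hy0, map_one]
  inv_val := by
    have hy0 : y ≠ 0 := by intro h; rw [h, norm_zero] at hy; norm_num at hy
    apply Subtype.ext
    simp only [MulMemClass.coe_mul, OneMemClass.coe_one]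
    rw [← map_mul, inv_mul_cancel₀ hy0, map_one]

/-- `xval (unitOf hy) = y`. [folklore] -/
@[simp] theorem xval_unitOf {y : K7} (hy : ‖y‖ = 1) : xval (unitOf hy) = y :=
  e7.apply_symm_apply y

/-! ## 3. The defect unit and the shear -/

/-- `log(x u)` lies in the log-ball `B(0, ‖Ω‖)`. [folklore] -/
theorem norm_unitLog_xval (u : (↥(v7.adicCompletionIntegers ↥F7))ˣ) :
    ‖unitLog (xval u)‖ ≤ ‖Omega‖ := by
  have h := unitLog_mem_logUnits (norm_xval u)
  rw [logUnits_eq_ball, mem_closedBall_zero_iff] at h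
  exact h

/-- The defect of `log(x u)` stays in the log-ball. [folklore] -/
theorem norm_dlin_unitLog (u : (↥(v7.adicCompletionIntegers ↥F7))ˣ) :
    ‖dlin (unitLog (xval u))‖ ≤ ‖Omega‖ :=
  norm_dlin_le (norm_unitLog_xval u)

/-- **The defect value `E(u) := exp(d(log(x u)))`**. [folklore] -/
def defectVal (u : (↥(v7.adicCompletionIntegers ↥F7))ˣ) : K7 :=
  expB (dlin (unitLog (xval u)))

/-- `‖E(u)‖ = 1`. [folklore] -/
theorem norm_defectVal (u : (↥(v7.adicCompletionIntegers ↥F7))ˣ) : ‖defectVal u‖ = 1 :=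
  norm_expB (norm_dlin_unitLog u)

/-- `log E(u) = d(log(x u))`. [folklore] -/
theorem unitLog_defectVal (u : (↥(v7.adicCompletionIntegers ↥F7))ˣ) :
    unitLog (defectVal u) = dlin (unitLog (xval u)) :=
  unitLog_expB (norm_dlin_unitLog u)

/-- `E(u)` is within `‖Ω‖` of `1`. [folklore] -/
theorem norm_one_sub_defectVal (u : (↥(v7.adicCompletionIntegers ↥F7))ˣ) :
    ‖1 - defectVal u‖ ≤ ‖Omega‖ :=
  (expB_spec (norm_dlin_unitLog u)).1

/-- `E(u) ≠ 0`. [folklore] -/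
theorem defectVal_ne_zero (u : (↥(v7.adicCompletionIntegers ↥F7))ˣ) : defectVal u ≠ 0 := by
  intro h
  have := norm_defectVal u
  rw [h, norm_zero] at this
  norm_num at this

/-- **The unit-group shear** `α(u) := u · E(u)`. [folklore] -/
def shearFun (u : (↥(v7.adicCompletionIntegers ↥F7))ˣ) : (↥(v7.adicCompletionIntegers ↥F7))ˣ :=
  u * unitOf (norm_defectVal u)

/-- `x(α u) = x(u)·E(u)`. [folklore] -/
theorem xval_shearFun (u : (↥(v7.adicCompletionIntegers ↥F7))ˣ) :
    xval (shearFun u) = xval u * defectVal u := by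
  rw [shearFun, xval_mul, xval_unitOf]

/-- **`log(x(α u)) = g(log(x u))`** — the shear is the log-conjugate of the shear-reflection `g`.
[folklore] -/
theorem unitLog_xval_shearFun (u : (↥(v7.adicCompletionIntegers ↥F7))ˣ) :
    unitLog (xval (shearFun u)) = glin (unitLog (xval u)) := by
  rw [xval_shearFun, unitLog_mul 7 (norm_xval u) (norm_defectVal u), unitLog_defectVal,
    ← glin_apply']

/-- The defect of the sheared unit is the inverse defect. [folklore] -/
theorem defectVal_shearFun (u : (↥(v7.adicCompletionIntegers ↥F7))ˣ) :
    defectVal (shearFun u) = (defectVal u)⁻¹ := by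
  have hd : dlin (unitLog (xval (shearFun u))) = - dlin (unitLog (xval u)) := by
    rw [unitLog_xval_shearFun, glin_apply', map_add, dlin_dlin,
      show dlin (unitLog (xval u)) + (-2 : ℚ_[7]) • dlin (unitLog (xval u)) =
        ((1 : ℚ_[7]) + -2) • dlin (unitLog (xval u)) by rw [add_smul, one_smul],
      show ((1 : ℚ_[7]) + -2) = -1 by norm_num, neg_one_smul]
  rw [defectVal, hd, expB_neg (norm_dlin_unitLog u), defectVal]

/-- **`α` is an involution.** [folklore] -/
theorem shearFun_shearFun (u : (↥(v7.adicCompletionIntegers ↥F7))ˣ) :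
    shearFun (shearFun u) = u := by
  apply xval_injective
  rw [xval_shearFun, xval_shearFun, defectVal_shearFun, mul_assoc,
    mul_inv_cancel₀ (defectVal_ne_zero u), mul_one]

/-- **`α` is multiplicative.** [folklore] -/
theorem shearFun_mul (u w : (↥(v7.adicCompletionIntegers ↥F7))ˣ) :
    shearFun (u * w) = shearFun u * shearFun w := by
  apply xval_injective
  have hE : defectVal (u * w) = defectVal u * defectVal w := by
    rw [defectVal, defectVal, defectVal, xval_mul,
      unitLog_mul 7 (norm_xval u) (norm_xval w), map_add,
      expB_add (norm_dlin_unitLog u) (norm_dlin_unitLog w)]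
  rw [xval_shearFun, xval_mul, hE, xval_mul, xval_shearFun, xval_shearFun]
  ring

/-- **The unit-group shear as an automorphism of `𝒪_{v₇}^×`** (involutive). [folklore] -/
def shearEquiv : (↥(v7.adicCompletionIntegers ↥F7))ˣ ≃* (↥(v7.adicCompletionIntegers ↥F7))ˣ :=
  { toFun := shearFun
    invFun := shearFun
    left_inv := shearFun_shearFun
    right_inv := shearFun_shearFun
    map_mul' := shearFun_mul }

/-- `shearEquiv` applied. [folklore] -/
@[simp] theorem shearEquiv_apply (u : (↥(v7.adicCompletionIntegers ↥F7))ˣ) :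
    shearEquiv u = shearFun u := rfl

/-! ## 4. The rigidity clauses: `α` satisfies every constraint the tree has proved for `liftUnits` -/

/-- **`α` fixes the torsion `μ` pointwise** (as `liftUnits` does for inner `φ`, and as every
`liftUnits` does on `μ` up to the filtration). [folklore] -/
theorem shearFun_of_pow_eq_one {z : (↥(v7.adicCompletionIntegers ↥F7))ˣ} {n : ℕ}
    (hn : 0 < n) (h : z ^ n = 1) : shearFun z = z := by
  have hlog : unitLog (xval z) = 0 :=
    unitLog_eq_zero_of_pow_eq_one 7 hn (by rw [← xval_pow, h, xval_one])
  have hE : defectVal z = 1 := by rw [defectVal, hlog, map_zero, expB_zero]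
  apply xval_injective
  rw [xval_shearFun, hE, mul_one]

/-- **`α` preserves the principal units `U^{(1)}`**. [folklore] -/
theorem shearFun_principal {u : (↥(v7.adicCompletionIntegers ↥F7))ˣ}
    (hu : ‖1 - xval u‖ ≤ ‖Omega‖) : ‖1 - xval (shearFun u)‖ ≤ ‖Omega‖ := by
  rw [xval_shearFun,
    show (1 : K7) - xval u * defectVal u = (1 - xval u) * defectVal u + (1 - defectVal u) by ring]
  refine (norm_add_le_max _ _).trans (max_le ?_ (norm_one_sub_defectVal u))
  rw [norm_mul, norm_defectVal, mul_one]
  exact hu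

/-- Coordinates of `1`: `(1, 0)`. [folklore] -/
theorem repr_one : bs7.repr (1 : K7) 0 = 1 ∧ bs7.repr (1 : K7) 1 = 0 := by
  have h : (1 : K7) = (1 : ℚ_[7]) • (1 : K7) + (0 : ℚ_[7]) • Omega := by
    rw [one_smul, zero_smul, add_zero]
  rw [h]
  exact repr_combo 1 0

/-- **`N_{K₇/ℚ₇}(E(u)) = 1`** — the defect is norm-one: its log is trace-free (`Tr(c·Ω) = 0`), so
`log₇ N(E) = 0` (`unitLog_norm_eq_trace_unitLog`), `N(E)` is a principal unit of `ℚ₇` (coordinate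
estimate via `N = a² − 7b²`), and `log₇` is injective there. [folklore] -/
theorem algebraNorm_defectVal (u : (↥(v7.adicCompletionIntegers ↥F7))ˣ) :
    Algebra.norm ℚ_[7] (defectVal u) = 1 := by
  -- (a) `log₇(N E) = Tr(log E) = Tr(δ·Ω) = 0`
  have htr : unitLog (Algebra.norm ℚ_[7] (defectVal u)) = 0 := by
    rw [unitLog_norm_eq_trace_unitLog 7 (norm_defectVal u), unitLog_defectVal, dlin_apply,
      trace_smul_omega]
  -- (b) `‖1 − N E‖ ≤ 7⁻¹`: coordinates
  have hprin : ‖(1 : ℚ_[7]) - Algebra.norm ℚ_[7] (defectVal u)‖ ≤ (((7 : ℕ) : ℝ))⁻¹ := by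
    set a : ℚ_[7] := bs7.repr (defectVal u) 0 with ha
    set b : ℚ_[7] := bs7.repr (defectVal u) 1 with hb
    -- coordinates of `E − 1 = −(1 − E)`, which lies in the log-ball
    have hw : ‖defectVal u - 1‖ ≤ ‖Omega‖ := by
      rw [← norm_neg, neg_sub]; exact norm_one_sub_defectVal u
    obtain ⟨hw0, hw1⟩ := coords_of_mem_ball hw
    have hwa : bs7.repr (defectVal u - 1) 0 = a - 1 := by
      rw [map_sub, Finsupp.sub_apply, repr_one.1, ha]
    have hwb : bs7.repr (defectVal u - 1) 1 = b := by
      rw [map_sub, Finsupp.sub_apply, repr_one.2, hb, sub_zero]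
    rw [hwa] at hw0
    rw [hwb] at hw1
    -- `1 − N(E) = −((a−1)(a+1) − 7b²)`
    rw [norm_coords]
    have hexp : (1 : ℚ_[7]) - (a ^ 2 - 7 * b ^ 2) = -((a - 1) * (a + 1) - 7 * b ^ 2) := by ring
    rw [hexp, norm_neg, sub_eq_add_neg]
    refine (norm_add_le_max _ _).trans (max_le ?_ ?_)
    · -- `‖(a−1)(a+1)‖ ≤ 7⁻¹`
      rw [norm_mul]
      have h1 : ‖a + 1‖ ≤ 1 := by
        have := norm_add_le_max (a - 1) (1 + 1)
        rw [show a - 1 + (1 + 1) = a + 1 by ring] at this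
        refine this.trans (max_le ?_ ?_)
        · refine hw0.trans ?_
          rw [norm_omega_sq]
          norm_num
        · have h2 : ‖(1 : ℚ_[7]) + 1‖ = 1 := by
            rw [show (1 : ℚ_[7]) + 1 = 2 by norm_num, norm_two_q7]
          exact h2.le
      calc ‖a - 1‖ * ‖a + 1‖ ≤ (((7 : ℕ) : ℝ))⁻¹ * 1 := by
            refine mul_le_mul ?_ h1 (norm_nonneg _) (by norm_num)
            exact hw0.trans (by rw [norm_omega_sq])
        _ = (((7 : ℕ) : ℝ))⁻¹ := mul_one _
    · -- `‖7b²‖ ≤ 7⁻¹`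
      rw [norm_neg, norm_mul, norm_seven_q7, pow_two, norm_mul]
      calc (((7 : ℕ) : ℝ))⁻¹ * (‖b‖ * ‖b‖) ≤ (((7 : ℕ) : ℝ))⁻¹ * (1 * 1) := by
            refine mul_le_mul_of_nonneg_left ?_ (by positivity)
            exact mul_le_mul hw1 hw1 (norm_nonneg _) (by norm_num)
        _ = (((7 : ℕ) : ℝ))⁻¹ := by rw [mul_one, mul_one]
  -- (c) injectivity of `log₇` on the principal units of `ℚ₇`
  have hP : IsPrincipal (Algebra.norm ℚ_[7] (defectVal u)) :=
    lt_of_le_of_lt hprin (by norm_num)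
  refine (logSeries_injOn 7 ℚ_[7] theta_q7_lt_one ?_ ?_ ?_).symm
  · show ‖(1 : ℚ_[7]) - 1‖ ≤ (((7 : ℕ) : ℝ))⁻¹
    rw [sub_self, norm_zero]
    norm_num
  · exact hprin
  · rw [← unitLog_of_isPrincipal 7 hP, htr, ← logSeries_one (K := ℚ_[7])]

/-- **`α` is NORM-RIGID**: `N_{K₇/ℚ₇}(x(α u)) = N_{K₇/ℚ₇}(x u)` — the constraint
`norm_liftUnits_of_mem` proves for every print-(Ind1) units transport (the `ℚ₇`-structure IS
`LocalField.adicCompletionPadicAlgebra v₇ 7`, definitionally). [cite: MochizukiAbsAnab2004, Prop 1.2.1 (vi) p.10] -/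
theorem algebraNorm_xval_shearFun (u : (↥(v7.adicCompletionIntegers ↥F7))ˣ) :
    Algebra.norm ℚ_[7] (xval (shearFun u)) = Algebra.norm ℚ_[7] (xval u) := by
  rw [xval_shearFun, map_mul, algebraNorm_defectVal, mul_one]

/-! ## 5. The mover witness: `α` moves `μ·U^{(2)}` -/

/-- `‖Ω‖² < 1`. [folklore] -/
theorem norm_omega_sq_lt_one : ‖Omega‖ ^ 2 < 1 := by
  obtain ⟨h0, h1⟩ := norm_omega_pos_lt_one
  nlinarith

/-- `‖7 + Ω‖ = ‖Ω‖` (distinct ultrametric sizes: `‖7‖ = ‖Ω‖² < ‖Ω‖`). [folklore] -/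
theorem norm_seven_add_omega : ‖(7 : K7) + Omega‖ = ‖Omega‖ := by
  obtain ⟨h0, h1⟩ := norm_omega_pos_lt_one
  have hlt : ‖(7 : K7)‖ < ‖Omega‖ := by
    rw [norm_seven_K7]
    nlinarith
  refine le_antisymm ((norm_add_le_max _ _).trans (max_le hlt.le le_rfl)) ?_
  by_contra hc
  push Not at hc
  have h2 : Omega = ((7 : K7) + Omega) + (-(7 : K7)) := by ring
  have h3 : ‖Omega‖ ≤ max ‖(7 : K7) + Omega‖ ‖(-(7 : K7))‖ := by
    conv_lhs => rw [h2]
    exact norm_add_le_max _ _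
  rw [norm_neg] at h3
  exact absurd (h3.trans_lt (max_lt hc hlt)) (lt_irrefl _)

/-- **THE MOVER WITNESS**: there is `u₀ ∈ U^{(2)}` (i.e. `‖1 − u₀‖ ≤ ‖Ω‖²`, `v(u₀ − 1) ≥ 2`) such that
`α u₀ ∉ μ·U^{(2)}`: no decomposition `α u₀ = ζ·w` with `ζ` torsion and `w ∈ U^{(2)}` exists
(`log α(u₀) = 7 + Ω` has norm `‖Ω‖ > ‖Ω‖²`, while `log(ζ·w)` has norm `≤ ‖Ω‖²`). [folklore] -/
theorem exists_mover_witness :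
    ∃ u₀ : (↥(v7.adicCompletionIntegers ↥F7))ˣ, ‖1 - xval u₀‖ ≤ ‖Omega‖ ^ 2 ∧
      ¬ ∃ (z w : (↥(v7.adicCompletionIntegers ↥F7))ˣ),
          (∃ n : ℕ, 0 < n ∧ z ^ n = 1) ∧ ‖1 - xval w‖ ≤ ‖Omega‖ ^ 2 ∧ shearFun u₀ = z * w := by
  have h7K : ‖(7 : K7)‖ ≤ ‖Omega‖ ^ 2 := by rw [norm_seven_K7]
  obtain ⟨x₀, hx₀b, hx₀l⟩ := exists_logSeries_eq 7 K7 theta_rad2_lt_one h7K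
  have hx₀n : ‖x₀‖ = 1 :=
    norm_eq_one_of_norm_one_sub_lt (lt_of_le_of_lt hx₀b norm_omega_sq_lt_one)
  refine ⟨unitOf hx₀n, by rw [xval_unitOf]; exact hx₀b, ?_⟩
  rintro ⟨z, w, ⟨n, hn, hzn⟩, hw, heq⟩
  -- the log of the sheared witness is `7 + Ω`, of norm `‖Ω‖`
  have hlhs : unitLog (xval (shearFun (unitOf hx₀n))) = (7 : K7) + Omega := by
    rw [unitLog_xval_shearFun, xval_unitOf,
      unitLog_of_isPrincipal 7 (lt_of_le_of_lt hx₀b norm_omega_sq_lt_one), hx₀l,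
      glin_apply, dcoef_seven, one_smul]
  -- but the log of `z·w` has norm `≤ ‖Ω‖²`
  have hrhs : ‖unitLog (xval (shearFun (unitOf hx₀n)))‖ ≤ ‖Omega‖ ^ 2 := by
    rw [heq, xval_mul, unitLog_mul 7 (norm_xval z) (norm_xval w),
      unitLog_eq_zero_of_pow_eq_one 7 hn (by rw [← xval_pow, hzn, xval_one]), zero_add,
      unitLog_of_isPrincipal 7 (lt_of_le_of_lt hw norm_omega_sq_lt_one)]
    exact (norm_logSeries_le_norm 7 K7 theta_rad2_lt_one.le hw).trans hw
  rw [hlhs, norm_seven_add_omega] at hrhs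
  obtain ⟨h0, h1⟩ := norm_omega_pos_lt_one
  nlinarith

/-! ## 6. The headline -/

/-- **THE FREEDOM THEOREM** (answer-side of c312-1 g8's R9f question, 2026-08-26T16:41:26Z): at the tame
quadratically ramified place `v₇ = (√7)` of `F₇ = ℚ(√7)` there is an INVOLUTIVE automorphism `α` of
`𝒪_{v₇}^×` that (i) is norm-rigid — the constraint `norm_liftUnits_of_mem` establishes for EVERY
print-(Ind1) units transport `Real.liftUnits v φ` —, (ii) fixes the torsion `μ` pointwise, (iii)
preserves the principal units `U^{(1)}`, and yet (iv) MOVES `μ·U^{(2)}`: some `u₀ ∈ U^{(2)}` has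
`α u₀ ∉ μ·U^{(2)}`.  Hence the constraint set the tree has proved about `Real.liftUnits` does NOT decide
whether print's (Ind1) preserves the higher unit groups `μ·U_v^{(m)}`, `m ≥ 2`: the `∀`-horn needs
non-abelian input, and the `∃`-horn is exactly the lifting statement «some `φ ∈ Aut_top(G_{v₇})` has
`liftUnits v₇ φ = α`» (GAP-LEDGER row G-c312-14-R9f). [cite: MochizukiAbsAnab2004, Prop 1.2.1 (iii) p.10]
[claim: Mochizuki2012, status: disputed] -/
theorem exists_normRigid_involution_moves_muU2 :
    ∃ α : (↥(v7.adicCompletionIntegers ↥F7))ˣ ≃* (↥(v7.adicCompletionIntegers ↥F7))ˣ,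
      (∀ u, α (α u) = u) ∧
      (∀ u, Algebra.norm ℚ_[7] (xval (α u)) = Algebra.norm ℚ_[7] (xval u)) ∧
      (∀ z, (∃ n : ℕ, 0 < n ∧ z ^ n = 1) → α z = z) ∧
      (∀ u, ‖1 - xval u‖ ≤ ‖Omega‖ → ‖1 - xval (α u)‖ ≤ ‖Omega‖) ∧
      ∃ u₀, ‖1 - xval u₀‖ ≤ ‖Omega‖ ^ 2 ∧
        ¬ ∃ z w, (∃ n : ℕ, 0 < n ∧ z ^ n = 1) ∧ ‖1 - xval w‖ ≤ ‖Omega‖ ^ 2 ∧ α u₀ = z * w := by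
  refine ⟨shearEquiv, fun u => shearFun_shearFun u, fun u => algebraNorm_xval_shearFun u,
    fun z ⟨n, hn, h⟩ => shearFun_of_pow_eq_one hn h, fun u hu => shearFun_principal hu, ?_⟩
  obtain ⟨u₀, h1, h2⟩ := exists_mover_witness
  exact ⟨u₀, h1, h2⟩

end Summit.ABC.IUTFork.Thm311.Real.UnitsShear

end
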